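import Mathlib

/-!
# Stub `stub_ladyzhenskaya` of line `Sketch` for crux `TameOrBrodyR4` (stmt-SmoothPoincare4-7826, route SullivanDual)

Ladyzhenskaya's inequality on `ℂ = ℝ²` for compactly supported smooth maps `W : ℂ → ℝ⁴`:
`∫ ‖W‖⁴ ≤ C (∫ ‖W‖²) (∫ ‖∂₁W‖² + ‖∂₂W‖²)` with `∂₁ = d·(1)`, `∂₂ = d·(I)`, for a constant `C`
depending on nothing (we take `C = 8 C₂` with `C₂` Mathlib's Gagliardo–Nirenberg–Sobolev constant
`MeasureTheory.lintegralPowLePowLIntegralFDerivConst volume 2` on `ℂ`).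

Proof outline (everything is done with lower Lebesgue integrals in `ℝ≥0∞` and converted to Bochner
integrals at the very end):

* the real function `u := ‖W‖²` is `C¹` with compact support, so Mathlib's
  Gagliardo–Nirenberg–Sobolev inequality `MeasureTheory.lintegral_pow_le_pow_lintegral_fderiv`
  on `ℂ` (`finrank ℝ ℂ = 2`, Hölder conjugate exponent `2`) gives
  `∫ ‖W‖⁴ = ∫ |u|² ≤ C₂ (∫ ‖∇u‖)²` (`Ladyzhenskaya.lintegral_norm_pow_four_le`);
* pointwise `‖∇u‖ ≤ 2 ‖W‖ ‖∇W‖` (`HasFDerivAt.norm_sq`, `Ladyzhenskaya.enorm_fderiv_norm_sq_le`),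
  and the Cauchy–Schwarz inequality (`ENNReal.lintegral_mul_le_Lp_mul_Lq` with `p = q = 2`) gives
  `(∫ ‖W‖ ‖∇W‖)² ≤ (∫ ‖W‖²) (∫ ‖∇W‖²)`;
* a real-linear map `T` on `ℂ` satisfies `‖T‖ ≤ ‖T 1‖ + ‖T I‖`
  (`Ladyzhenskaya.opNorm_le_norm_one_add_norm_I`), hence `‖∇W‖² ≤ 2 (‖∂₁W‖² + ‖∂₂W‖²)`;
* all integrands are continuous with compact support, so the integrals are finite and the
  `ℝ≥0∞`-inequality transfers to real integrals.

Folklore (Ladyzhenskaya 1958; Gagliardo 1958 / Nirenberg 1959).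
-/

noncomputable section

open scoped ContDiff Topology ENNReal NNReal
open Filter Set MeasureTheory

-- the registered namespace `Summit.SmoothPoincare4.SmoothPoincare4.…` repeats a component
set_option linter.dupNamespace false

namespace Summit.SmoothPoincare4.SmoothPoincare4.Cruxes.TameOrBrodyR4.Sketch

/-- Local notation for the model space `ℝ⁴ = EuclideanSpace ℝ (Fin 4)`. -/
local notation "E4" => EuclideanSpace ℝ (Fin 4)

namespace Ladyzhenskaya

variable {F : Type*} [NormedAddCommGroup F] [NormedSpace ℝ F]

/-- A continuous real-linear map on `ℂ` is controlled by its values at `1` and `I`: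
`‖T‖ ≤ ‖T 1‖ + ‖T I‖`. -/
theorem opNorm_le_norm_one_add_norm_I (T : ℂ →L[ℝ] F) : ‖T‖ ≤ ‖T 1‖ + ‖T Complex.I‖ := by
  refine ContinuousLinearMap.opNorm_le_bound _ (by positivity) fun v => ?_
  have hv : v = v.re • (1 : ℂ) + v.im • Complex.I := by
    rw [Complex.real_smul, Complex.real_smul, mul_one, Complex.re_add_im]
  calc ‖T v‖ = ‖T (v.re • (1 : ℂ) + v.im • Complex.I)‖ := by rw [← hv]
    _ = ‖v.re • T 1 + v.im • T Complex.I‖ := by rw [map_add, map_smul, map_smul]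
    _ ≤ ‖v.re • T 1‖ + ‖v.im • T Complex.I‖ := norm_add_le _ _
    _ = |v.re| * ‖T 1‖ + |v.im| * ‖T Complex.I‖ := by
        rw [norm_smul, norm_smul, Real.norm_eq_abs, Real.norm_eq_abs]
    _ ≤ ‖v‖ * ‖T 1‖ + ‖v‖ * ‖T Complex.I‖ := by
        gcongr
        · exact Complex.abs_re_le_norm v
        · exact Complex.abs_im_le_norm v
    _ = (‖T 1‖ + ‖T Complex.I‖) * ‖v‖ := by ring

/-- Squared `ℝ≥0∞` version of `opNorm_le_norm_one_add_norm_I`: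
`‖T‖² ≤ 2 (‖T 1‖² + ‖T I‖²)`. -/
theorem enorm_sq_le (T : ℂ →L[ℝ] F) :
    ‖T‖ₑ ^ 2 ≤ 2 * (‖T 1‖ₑ ^ 2 + ‖T Complex.I‖ₑ ^ 2) := by
  have h1 := opNorm_le_norm_one_add_norm_I T
  have h : ‖T‖ ^ 2 ≤ 2 * (‖T 1‖ ^ 2 + ‖T Complex.I‖ ^ 2) := by
    nlinarith [norm_nonneg T, norm_nonneg (T 1), norm_nonneg (T Complex.I),
      sq_nonneg (‖T 1‖ - ‖T Complex.I‖)]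
  calc ‖T‖ₑ ^ 2 = ENNReal.ofReal (‖T‖ ^ 2) := by
        rw [ENNReal.ofReal_pow (norm_nonneg _), ofReal_norm]
    _ ≤ ENNReal.ofReal (2 * (‖T 1‖ ^ 2 + ‖T Complex.I‖ ^ 2)) := ENNReal.ofReal_le_ofReal h
    _ = 2 * (‖T 1‖ₑ ^ 2 + ‖T Complex.I‖ₑ ^ 2) := by
        rw [ENNReal.ofReal_mul zero_le_two, ENNReal.ofReal_add (by positivity) (by positivity),
          ENNReal.ofReal_pow (norm_nonneg _), ENNReal.ofReal_pow (norm_nonneg _), ofReal_norm,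
          ofReal_norm, ENNReal.ofReal_ofNat]

/-- The derivative of `‖W‖²` is bounded by `2 ‖W‖ ‖dW‖` (in `ℝ≥0∞`). -/
theorem enorm_fderiv_norm_sq_le {W : ℂ → E4} (hW : Differentiable ℝ W) (z : ℂ) :
    ‖fderiv ℝ (fun z => ‖W z‖ ^ 2) z‖ₑ ≤ 2 * (‖W z‖ₑ * ‖fderiv ℝ W z‖ₑ) := by
  have h : ‖fderiv ℝ (fun z => ‖W z‖ ^ 2) z‖ ≤ 2 * (‖W z‖ * ‖fderiv ℝ W z‖) := by
    rw [(hW z).hasFDerivAt.norm_sq.fderiv]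
    calc ‖(2 • (innerSL ℝ (W z)).comp (fderiv ℝ W z))‖
        ≤ 2 * ‖(innerSL ℝ (W z)).comp (fderiv ℝ W z)‖ := by
          rw [two_smul]
          exact (norm_add_le _ _).trans_eq (two_mul _).symm
      _ ≤ 2 * (‖innerSL ℝ (W z)‖ * ‖fderiv ℝ W z‖) := by
          gcongr
          exact ContinuousLinearMap.opNorm_comp_le _ _
      _ = 2 * (‖W z‖ * ‖fderiv ℝ W z‖) := by rw [innerSL_apply_norm]
  calc ‖fderiv ℝ (fun z => ‖W z‖ ^ 2) z‖ₑ
      = ENNReal.ofReal ‖fderiv ℝ (fun z => ‖W z‖ ^ 2) z‖ := (ofReal_norm _).symm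
    _ ≤ ENNReal.ofReal (2 * (‖W z‖ * ‖fderiv ℝ W z‖)) := ENNReal.ofReal_le_ofReal h
    _ = 2 * (‖W z‖ₑ * ‖fderiv ℝ W z‖ₑ) := by
        rw [ENNReal.ofReal_mul zero_le_two, ENNReal.ofReal_mul (norm_nonneg _), ofReal_norm,
          ofReal_norm, ENNReal.ofReal_ofNat]

/-- **Ladyzhenskaya's inequality in `ℝ≥0∞` form.** For a compactly supported `C^∞` map
`W : ℂ → ℝ⁴`: `∫⁻ ‖W‖⁴ ≤ 8 C₂ (∫⁻ ‖W‖²) (∫⁻ ‖∂₁W‖² + ‖∂₂W‖²)`, where `C₂` is the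
Gagliardo–Nirenberg–Sobolev constant of `ℂ` for the exponent `2`. -/
theorem lintegral_norm_pow_four_le {W : ℂ → E4} (hW : ContDiff ℝ ∞ W)
    (hWc : HasCompactSupport W) :
    ∫⁻ z, ‖W z‖ₑ ^ 4 ≤
      ((8 * lintegralPowLePowLIntegralFDerivConst (volume : Measure ℂ) 2 : ℝ≥0) : ℝ≥0∞) *
        ((∫⁻ z, ‖W z‖ₑ ^ 2) *
          ∫⁻ z, (‖fderiv ℝ W z 1‖ₑ ^ 2 + ‖fderiv ℝ W z Complex.I‖ₑ ^ 2)) := by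
  set C := lintegralPowLePowLIntegralFDerivConst (volume : Measure ℂ) 2
  set u : ℂ → ℝ := fun z => ‖W z‖ ^ 2 with hu_def
  have hu : ContDiff ℝ 1 u := (hW.norm_sq ℝ).of_le (mod_cast le_top)
  have h2u : HasCompactSupport u := hWc.comp_left (g := fun v : E4 => ‖v‖ ^ 2) (by simp)
  have hp : Real.HolderConjugate (Module.finrank ℝ ℂ : ℝ) 2 := by
    rw [Complex.finrank_real_complex, Nat.cast_ofNat]
    exact Real.HolderConjugate.two_two
  have hGNS := lintegral_pow_le_pow_lintegral_fderiv (volume : Measure ℂ) hu h2u hp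
  have hWd : Differentiable ℝ W := hW.differentiable (by simp)
  have hWm : AEMeasurable (fun z => ‖W z‖ₑ) (volume : Measure ℂ) :=
    hW.continuous.enorm.aemeasurable
  have hdWm : AEMeasurable (fun z => ‖fderiv ℝ W z‖ₑ) (volume : Measure ℂ) :=
    (hW.continuous_fderiv (by simp)).enorm.aemeasurable
  -- Step 1: the left-hand side is `∫⁻ |u|²`.
  have h1 : ∫⁻ z, ‖W z‖ₑ ^ 4 = ∫⁻ x, ‖u x‖ₑ ^ (2 : ℝ) := by
    refine lintegral_congr fun z => ?_
    rw [ENNReal.rpow_two, hu_def]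
    simp only
    rw [Real.enorm_eq_ofReal (by positivity), ENNReal.ofReal_pow (norm_nonneg _), ofReal_norm,
      ← pow_mul]
  -- Step 2: `∫⁻ ‖∇u‖ ≤ 2 ∫⁻ ‖W‖ ‖∇W‖`.
  have h2 : ∫⁻ x, ‖fderiv ℝ u x‖ₑ ≤ 2 * ∫⁻ z, ‖W z‖ₑ * ‖fderiv ℝ W z‖ₑ := by
    rw [← lintegral_const_mul' _ _ ENNReal.ofNat_ne_top]
    exact lintegral_mono fun z => enorm_fderiv_norm_sq_le hWd z
  -- Step 3: Cauchy–Schwarz.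
  have h3 : (∫⁻ z, ‖W z‖ₑ * ‖fderiv ℝ W z‖ₑ) ^ 2 ≤
      (∫⁻ z, ‖W z‖ₑ ^ 2) * ∫⁻ z, ‖fderiv ℝ W z‖ₑ ^ 2 := by
    have hCS := ENNReal.lintegral_mul_le_Lp_mul_Lq volume Real.HolderConjugate.two_two hWm hdWm
    simp only [Pi.mul_apply, ENNReal.rpow_two] at hCS
    calc (∫⁻ z, ‖W z‖ₑ * ‖fderiv ℝ W z‖ₑ) ^ 2
        ≤ ((∫⁻ z, ‖W z‖ₑ ^ 2) ^ (1 / 2 : ℝ) * (∫⁻ z, ‖fderiv ℝ W z‖ₑ ^ 2) ^ (1 / 2 : ℝ)) ^ 2 := by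
          gcongr
      _ = (∫⁻ z, ‖W z‖ₑ ^ 2) * ∫⁻ z, ‖fderiv ℝ W z‖ₑ ^ 2 := by
          rw [mul_pow, ← ENNReal.rpow_two, ← ENNReal.rpow_two, ← ENNReal.rpow_mul,
            ← ENNReal.rpow_mul]
          norm_num
  -- Step 4: `‖∇W‖² ≤ 2 (‖∂₁W‖² + ‖∂₂W‖²)`.
  have h4 : ∫⁻ z, ‖fderiv ℝ W z‖ₑ ^ 2 ≤
      2 * ∫⁻ z, (‖fderiv ℝ W z 1‖ₑ ^ 2 + ‖fderiv ℝ W z Complex.I‖ₑ ^ 2) := by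
    rw [← lintegral_const_mul' _ _ ENNReal.ofNat_ne_top]
    exact lintegral_mono fun z => enorm_sq_le (fderiv ℝ W z)
  calc ∫⁻ z, ‖W z‖ₑ ^ 4 = ∫⁻ x, ‖u x‖ₑ ^ (2 : ℝ) := h1
    _ ≤ C * (∫⁻ x, ‖fderiv ℝ u x‖ₑ) ^ (2 : ℝ) := hGNS
    _ = C * (∫⁻ x, ‖fderiv ℝ u x‖ₑ) ^ 2 := by rw [ENNReal.rpow_two]
    _ ≤ C * (2 * ∫⁻ z, ‖W z‖ₑ * ‖fderiv ℝ W z‖ₑ) ^ 2 := by gcongr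
    _ = C * 4 * (∫⁻ z, ‖W z‖ₑ * ‖fderiv ℝ W z‖ₑ) ^ 2 := by ring
    _ ≤ C * 4 * ((∫⁻ z, ‖W z‖ₑ ^ 2) * ∫⁻ z, ‖fderiv ℝ W z‖ₑ ^ 2) := by gcongr
    _ ≤ C * 4 * ((∫⁻ z, ‖W z‖ₑ ^ 2) *
        (2 * ∫⁻ z, (‖fderiv ℝ W z 1‖ₑ ^ 2 + ‖fderiv ℝ W z Complex.I‖ₑ ^ 2))) := by gcongr
    _ = ((8 * C : ℝ≥0) : ℝ≥0∞) * ((∫⁻ z, ‖W z‖ₑ ^ 2) *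
        ∫⁻ z, (‖fderiv ℝ W z 1‖ₑ ^ 2 + ‖fderiv ℝ W z Complex.I‖ₑ ^ 2)) := by
      push_cast
      ring

/-- The integral of `‖W‖ ^ n` is the real part of the lower Lebesgue integral of `‖W‖ₑ ^ n`. -/
theorem integral_norm_pow_eq {W : ℂ → E4} (hW : Continuous W) (n : ℕ) :
    ∫ z, ‖W z‖ ^ n = (∫⁻ z, ‖W z‖ₑ ^ n).toReal := by
  rw [integral_eq_lintegral_of_nonneg_ae (f := fun z => ‖W z‖ ^ n)
    (Eventually.of_forall fun z => by positivity) (by fun_prop)]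
  congr 1
  refine lintegral_congr fun z => ?_
  rw [ENNReal.ofReal_pow (norm_nonneg _), ofReal_norm]

/-- Finiteness of `∫⁻ ‖W‖ₑ ^ n` for a continuous compactly supported `W`. -/
theorem lintegral_norm_pow_lt_top {W : ℂ → E4} (hW : Continuous W) (hWc : HasCompactSupport W)
    {n : ℕ} (hn : n ≠ 0) : ∫⁻ z, ‖W z‖ₑ ^ n < ⊤ := by
  have hi : Integrable (fun z => ‖W z‖ ^ n) (volume : Measure ℂ) :=
    (hW.norm.pow n).integrable_of_hasCompactSupport
      (hWc.comp_left (g := fun v : E4 => ‖v‖ ^ n) (by simp [hn]))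
  have hfi := hi.hasFiniteIntegral
  rw [hasFiniteIntegral_iff_enorm] at hfi
  refine lt_of_eq_of_lt (lintegral_congr fun z => ?_) hfi
  rw [Real.enorm_eq_ofReal (by positivity), ENNReal.ofReal_pow (norm_nonneg _), ofReal_norm]

end Ladyzhenskaya

/-- **Stub `stub_ladyzhenskaya` (Ladyzhenskaya's inequality on `ℝ²`).** There is a constant `C`
such that for every compactly supported `C^∞` map `W : ℂ → ℝ⁴`,
`∫ ‖W‖⁴ ≤ C (∫ ‖W‖²) (∫ ‖∂₁W‖² + ‖∂₂W‖²)`, where `∂₁W = dW(1)` and `∂₂W = dW(I)`.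
Proof: `Ladyzhenskaya.lintegral_norm_pow_four_le` (Gagliardo–Nirenberg–Sobolev for `‖W‖²` +
Cauchy–Schwarz), transferred from `ℝ≥0∞` to real integrals (all integrands are continuous with
compact support, hence integrable). -/
theorem stub_ladyzhenskaya : ∃ C : ℝ, ∀ (W : ℂ → E4), ContDiff ℝ ∞ W → HasCompactSupport W →
    (∫ z, ‖W z‖ ^ 4) ≤ C * ((∫ z, ‖W z‖ ^ 2) *
      ∫ z, (‖fderiv ℝ W z 1‖ ^ 2 + ‖fderiv ℝ W z Complex.I‖ ^ 2)) := by
  refine ⟨((8 * lintegralPowLePowLIntegralFDerivConst (volume : Measure ℂ) 2 : ℝ≥0) : ℝ),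
    fun W hW hWc => ?_⟩
  have hmain := Ladyzhenskaya.lintegral_norm_pow_four_le hW hWc
  have hd1 : Continuous fun z => fderiv ℝ W z 1 :=
    (hW.continuous_fderiv (by simp)).clm_apply continuous_const
  have hdI : Continuous fun z => fderiv ℝ W z Complex.I :=
    (hW.continuous_fderiv (by simp)).clm_apply continuous_const
  -- the three real integrals as lower Lebesgue integrals
  have hA : ∫ z, ‖W z‖ ^ 4 = (∫⁻ z, ‖W z‖ₑ ^ 4).toReal :=
    Ladyzhenskaya.integral_norm_pow_eq hW.continuous 4
  have hB : ∫ z, ‖W z‖ ^ 2 = (∫⁻ z, ‖W z‖ₑ ^ 2).toReal :=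
    Ladyzhenskaya.integral_norm_pow_eq hW.continuous 2
  have hD : ∫ z, (‖fderiv ℝ W z 1‖ ^ 2 + ‖fderiv ℝ W z Complex.I‖ ^ 2) =
      (∫⁻ z, (‖fderiv ℝ W z 1‖ₑ ^ 2 + ‖fderiv ℝ W z Complex.I‖ₑ ^ 2)).toReal := by
    rw [integral_eq_lintegral_of_nonneg_ae
      (f := fun z => ‖fderiv ℝ W z 1‖ ^ 2 + ‖fderiv ℝ W z Complex.I‖ ^ 2)
      (Eventually.of_forall fun z => by positivity) (by fun_prop)]
    congr 1
    refine lintegral_congr fun z => ?_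
    rw [ENNReal.ofReal_add (by positivity) (by positivity), ENNReal.ofReal_pow (norm_nonneg _),
      ENNReal.ofReal_pow (norm_nonneg _), ofReal_norm, ofReal_norm]
  -- finiteness
  have hBfin : ∫⁻ z, ‖W z‖ₑ ^ 2 < ⊤ :=
    Ladyzhenskaya.lintegral_norm_pow_lt_top hW.continuous hWc two_ne_zero
  have hDfin : ∫⁻ z, (‖fderiv ℝ W z 1‖ₑ ^ 2 + ‖fderiv ℝ W z Complex.I‖ₑ ^ 2) < ⊤ := by
    rw [lintegral_add_left (hd1.enorm.measurable.pow_const 2)]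
    exact ENNReal.add_lt_top.mpr
      ⟨Ladyzhenskaya.lintegral_norm_pow_lt_top hd1 (hWc.fderiv_apply (𝕜 := ℝ) 1) two_ne_zero,
        Ladyzhenskaya.lintegral_norm_pow_lt_top hdI (hWc.fderiv_apply (𝕜 := ℝ) Complex.I)
          two_ne_zero⟩
  rw [hA, hB, hD, ← ENNReal.coe_toReal, ← ENNReal.toReal_mul, ← ENNReal.toReal_mul]
  exact ENNReal.toReal_mono
    (ENNReal.mul_ne_top ENNReal.coe_ne_top (ENNReal.mul_ne_top hBfin.ne hDfin.ne)) hmain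

end Summit.SmoothPoincare4.SmoothPoincare4.Cruxes.TameOrBrodyR4.Sketch
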